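import Summits.HubbardSuperconductivity.HubbardSuperconductivity.Theses.FixedNodeShadow
import Summits.HubbardSuperconductivity.HubbardSuperconductivity.Theorems.BalabanIRBirEveryGroundStateSchur
import Literature.MathematicalPhysics.QuantumLattice.SectorSpectrum

/-!
# Route `FixedNodeShadow`, support `FnEnergyWindow` (item stmt-HubbardSuperconductivity-2108)

F3 THE VARIATIONAL WINDOW OF THE NODE-RELEASE PATH. For complex matrices `A`, `D` on a finite index
type, a subspace `K`, and `0 ≠ w ∈ K` with `D w = 0` and `0 ≤ Re ⟨v, D v⟩` for all `v`:
for every `γ ≥ 0`, `minE_K(A) ≤ minE_K(A + γD) ≤ Re⟨w, A w⟩ / Re⟨w, w⟩` (the quadratic form only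
grows; test with `w/‖w‖`, on which `γD` vanishes); `γ ↦ minE_K(A + γD)` is non-decreasing and
CONCAVE (an infimum of affine functions of `γ`). `Matrix.minEnergyOn` is the Rayleigh-quotient
`sInf` of `FinDimSpectrum.lean`; nothing beyond `csInf_le` / `le_csInf` with the crude lower bound
`Re ⟨ψ, M ψ⟩ ≥ −Σ |M s t|` (`bddBelow_rayleighSet`) is used. Becca–Sorella (2017) §10.4
(eqs. (10.45)–(10.47)); Tasaki (2020) §2.1. [folklore]
-/

-- the mandated namespace `Summit.<Summit>.<Problem>.Theorems` repeats `HubbardSuperconductivity`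
-- (single-problem summit, D-0017), which the `dupNamespace` linter flags on every declaration
set_option linter.dupNamespace false

noncomputable section

namespace Summit.HubbardSuperconductivity.HubbardSuperconductivity.Theorems.FixedNodeShadow

open Matrix Literature.MathematicalPhysics.QuantumLattice
open scoped ComplexOrder

variable {n : Type*} [Fintype n]

/-- The Rayleigh numerator of an affine pencil: `Re⟨ψ, (A + γD)ψ⟩ = Re⟨ψ, Aψ⟩ + γ Re⟨ψ, Dψ⟩`.
[folklore] -/
theorem re_rayleigh_add_smul (A D : Matrix n n ℂ) (γ : ℝ) (ψ : n → ℂ) :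
    (star ψ ⬝ᵥ (A + (γ : ℂ) • D) *ᵥ ψ).re =
      (star ψ ⬝ᵥ A *ᵥ ψ).re + γ * (star ψ ⬝ᵥ D *ᵥ ψ).re := by
  rw [add_mulVec, dotProduct_add, smul_mulVec, dotProduct_smul, Complex.add_re, smul_eq_mul,
    Complex.re_ofReal_mul]

/-- **Comparison principle for sector energies**: if `Re⟨ψ, Bψ⟩ ≤ Re⟨ψ, Cψ⟩` for every unit
vector `ψ ∈ K` and `K` contains a unit vector, then `minE_K(B) ≤ minE_K(C)`. [folklore] -/
theorem minEnergyOn_le_minEnergyOn_of_forall (B C : Matrix n n ℂ) (K : Submodule ℂ (n → ℂ))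
    (hne : ∃ ψ ∈ K, star ψ ⬝ᵥ ψ = 1)
    (h : ∀ ψ ∈ K, star ψ ⬝ᵥ ψ = 1 → (star ψ ⬝ᵥ B *ᵥ ψ).re ≤ (star ψ ⬝ᵥ C *ᵥ ψ).re) :
    B.minEnergyOn K ≤ C.minEnergyOn K := by
  obtain ⟨ψ₀, hψ₀K, hψ₀⟩ := hne
  change B.minEnergyOn K ≤ sInf _
  refine le_csInf ⟨_, ψ₀, hψ₀K, hψ₀, rfl⟩ ?_
  rintro b ⟨ψ, hψK, hψ, rfl⟩
  exact (minEnergyOn_le_re_rayleigh B K hψK hψ).trans (h ψ hψK hψ)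

/-- **Concavity of the sector energy along an affine pencil**: for `t ∈ [0, 1]`,
`t·minE_K(A + γ₁D) + (1 − t)·minE_K(A + γ₂D) ≤ minE_K(A + (tγ₁ + (1 − t)γ₂)D)` — an infimum of
functions affine in `γ` is concave. [folklore] -/
theorem minEnergyOn_add_smul_concave (A D : Matrix n n ℂ) (K : Submodule ℂ (n → ℂ))
    (hne : ∃ ψ ∈ K, star ψ ⬝ᵥ ψ = 1) (γ₁ γ₂ t : ℝ) (ht : t ∈ Set.Icc (0 : ℝ) 1) :
    t * (A + (γ₁ : ℂ) • D).minEnergyOn K + (1 - t) * (A + (γ₂ : ℂ) • D).minEnergyOn K ≤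
      (A + ((t * γ₁ + (1 - t) * γ₂ : ℝ) : ℂ) • D).minEnergyOn K := by
  obtain ⟨ψ₀, hψ₀K, hψ₀⟩ := hne
  obtain ⟨ht0, ht1⟩ := ht
  change _ ≤ sInf _
  refine le_csInf ⟨_, ψ₀, hψ₀K, hψ₀, rfl⟩ ?_
  rintro b ⟨ψ, hψK, hψ, rfl⟩
  have h1 := minEnergyOn_le_re_rayleigh (A + (γ₁ : ℂ) • D) K hψK hψ
  have h2 := minEnergyOn_le_re_rayleigh (A + (γ₂ : ℂ) • D) K hψK hψ
  rw [re_rayleigh_add_smul] at h1 h2 ⊢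
  have h1' := mul_le_mul_of_nonneg_left h1 ht0
  have h2' := mul_le_mul_of_nonneg_left h2 (sub_nonneg.2 ht1)
  nlinarith [h1', h2']

/-- **The Rayleigh quotient of a multiple of `w` on a pencil pinned at `w`**: if `D w = 0` and
`c • w` is a unit vector, then `Re⟨c•w, (A + γD)(c•w)⟩ = Re⟨w, Aw⟩ / Re⟨w, w⟩`. [folklore] -/
theorem re_rayleigh_smul_of_mulVec_eq_zero (A D : Matrix n n ℂ) (γ : ℝ) {w : n → ℂ} {c : ℂ}
    (hDw : D *ᵥ w = 0) (hunit : star (c • w) ⬝ᵥ (c • w) = 1) :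
    (star (c • w) ⬝ᵥ (A + (γ : ℂ) • D) *ᵥ (c • w)).re =
      (star w ⬝ᵥ A *ᵥ w).re / (star w ⬝ᵥ w).re := by
  have hval : star (c • w) ⬝ᵥ (A + (γ : ℂ) • D) *ᵥ (c • w) =
      (star c * c) * (star w ⬝ᵥ A *ᵥ w) := by
    rw [mulVec_smul, add_mulVec, smul_mulVec, hDw, smul_zero, add_zero, star_smul,
      smul_dotProduct, dotProduct_smul, smul_smul, smul_eq_mul]
  have hnorm : (star c * c) * (star w ⬝ᵥ w) = 1 := by
    rw [← hunit, star_smul, smul_dotProduct, dotProduct_smul, smul_smul, smul_eq_mul]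
  have hq : (star c * c).im = 0 := by
    simp only [Complex.star_def, Complex.mul_im, Complex.conj_re, Complex.conj_im]
    ring
  have hs : (star w ⬝ᵥ w).im = 0 := by
    have h0 : (0 : ℂ) ≤ star w ⬝ᵥ w := dotProduct_star_self_nonneg w
    exact ((Complex.nonneg_iff.mp h0).2).symm
  have h1 : (star c * c).re * (star w ⬝ᵥ w).re = 1 := by
    have := congrArg Complex.re hnorm
    rw [Complex.mul_re, hq, zero_mul, sub_zero, Complex.one_re] at this
    exact this
  have hspos : (star w ⬝ᵥ w).re ≠ 0 := by
    intro h0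
    rw [h0, mul_zero] at h1
    exact zero_ne_one h1
  rw [hval, Complex.mul_re, hq, zero_mul, sub_zero, eq_div_iff hspos, mul_comm _ ((star w ⬝ᵥ w).re),
    ← mul_assoc, mul_comm ((star w ⬝ᵥ w).re), h1, one_mul]

/-- **`FnEnergyWindow`** (route `FixedNodeShadow`, item stmt-HubbardSuperconductivity-2108): the
variational window, monotonicity and concavity of `γ ↦ minE_K(A + γD)` for a positive `D` pinned
on `0 ≠ w ∈ K`. [cite: BeccaSorella2017, §10.4 eqs. (10.45)–(10.47)] -/
theorem fnEnergyWindow_proof :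
    Summit.HubbardSuperconductivity.HubbardSuperconductivity.Theses.FixedNodeShadow.FnEnergyWindow := by
  intro n _ _ A D K w hD hDw hwK hw0
  obtain ⟨c, -, hunit⟩ := exists_smul_unit hw0
  have hcwK : c • w ∈ K := K.smul_mem c hwK
  have hne : ∃ ψ ∈ K, star ψ ⬝ᵥ ψ = 1 := ⟨c • w, hcwK, hunit⟩
  refine ⟨fun γ hγ => ⟨?_, ?_⟩, fun γ₁ γ₂ _ hγ => ?_,
    fun γ₁ γ₂ t _ _ ht => minEnergyOn_add_smul_concave A D K hne γ₁ γ₂ t ht⟩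
  · -- the quadratic form only grows
    refine minEnergyOn_le_minEnergyOn_of_forall A _ K hne fun ψ _ _ => ?_
    rw [re_rayleigh_add_smul]
    exact le_add_of_nonneg_right (mul_nonneg hγ (hD ψ))
  · -- test with the normalised guiding vector, on which `γD` vanishes
    have h := minEnergyOn_le_re_rayleigh (A + (γ : ℂ) • D) K hcwK hunit
    rwa [re_rayleigh_smul_of_mulVec_eq_zero A D γ hDw hunit] at h
  · -- monotonicity in `γ`
    refine minEnergyOn_le_minEnergyOn_of_forall _ _ K hne fun ψ _ _ => ?_
    rw [re_rayleigh_add_smul, re_rayleigh_add_smul]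
    have := mul_le_mul_of_nonneg_right hγ (hD ψ)
    linarith

end Summit.HubbardSuperconductivity.HubbardSuperconductivity.Theorems.FixedNodeShadow

end
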